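import Mathlib
import HarnessLib
import Summits.HubbardSuperconductivity.HubbardSuperconductivity.Theorems.KLProgrammeMatsubaraRiemannSum
import Summits.HubbardSuperconductivity.HubbardSuperconductivity.Theorems.KLProgrammeKLRegimeTwoPointLimitZeroSound

/-!
# Route `KLProgramme` — crux K3 split, ENGINE child `KLRegimeEngineV7` (stmt-HubbardSuperconductivity-19662): the zero-sound bubble of a
# radial shell at FINITE temperature — the discrete Matsubara sum is `O(Lip(G)·r⁴·(r + 2π/β)/β)`, `M`-uniformly
# (cell gate-hubbard-kl, seat hubbard-kl-k3c2-p2 «thermal-bar induction n ≤ nScales β + 1»)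

p1's `…TwoPointLimitZeroSound` (`klzs_*`) proves the CONTINUUM core of DECOMP App. E Lemma E.2: `∫∫ F(k₀² + e²)(−ik₀ + e)^{−2} dk₀ de = 0`
for every radial weight `F` — and lists as «deliberately NOT here: the discrete Matsubara sum (Poisson-summation remainder and the
thermal layer)».  This module supplies that: at inverse temperature `β` the frequency integral is the fermionic Matsubara sum
`β⁻¹ Σ_{k₀ ∈ π(2ℤ+1)/β}` (the tree's `matsubaraFreq β M`, `2M` kept frequencies), which by `…MatsubaraRiemannSum` (`klmr_*`) is a midpoint
Riemann sum of the `e`-integrated integrand; since the continuum value is `0`, the discrete bubble is bounded by the Riemann error ALONE.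

We write the radial integrand in the SINGULARITY-FREE form `Ψ_G(k₀, e) := G(k₀² + e²)·(ik₀ + e)²`; for `s = k₀² + e² > 0` this is
`F(s)·(−ik₀ + e)^{−2}` with `F(s) = G(s)·s²` (`klzd_integrand_eq`: `(ik₀+e)² = s²/(−ik₀+e)²`), so a shell weight `F` supported in an annulus
`r₁² ≤ s ≤ r²` corresponds to `G = F/s²`, Lipschitz with `Lip(G) ≍ Lip(F)/r₁⁴ + sup|F|/r₁⁶`.  HYPOTHESES on `G : ℝ → ℂ`: `L`-Lipschitz and
`G(s) = 0` for `s ≥ r²` (`r > 0`).  RESULTS (`klzd_*`):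
* `Ψ_G(·, e)` is `4Lr³`-Lipschitz for every `e`, vanishes for `|k₀| ≥ r` or `|e| ≥ r`; `g(k₀) := ∫ Ψ_G(k₀, e) de` is `8Lr⁴`-Lipschitz and
  vanishes for `|k₀| ≥ r`; `∫ g = ∫∫ Ψ_G = 0` (Fubini + `klzs_integral_radial_mul_inv_pow_eq_zero`);
* **`klzd_discrete_zeroSound_bubble_norm_le`**: for `β > 0` and every `M ≥ βr/(2π) + 1`,
  `‖β⁻¹ • Σ_{i : MatsubaraIdx M} ∫ Ψ_G(ω_i, e) de‖ ≤ 8·L·r⁴·(r + 2π/β)/β`.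
SIZES at scale `n` (a single-slice weight): `r ≍ Λ_n`, `G ≍ Λ_n^{−4}` on an `s`-range `≍ Λ_n²`, so `L ≍ Λ_n^{−6}` and the bound is
`≍ Λ_n^{−2}·Λ_n/β = (βΛ_n)^{−1} ≍ (π/β)/Λ_n ≤ 4^{−(n_β−n)}` (`…SplitThermalLayer`): the (T) `thermalBar` profile of the engine slot, zero in
the continuum, `O(1)` only in the thermal layer.  A frequency rescaling `k₀ ↦ b k₀` (BGM's `1 + a_h`) is the same statement at inverse
temperature `β/b`.  Pure analysis; nothing about the model is asserted.
References: BGM 2006, Ann. Henri Poincaré 7 (2006) 809, §2.5 Lemma 2.2a, (2.38), (2.56e); HOME/p1/E2-NOTE.md §3 STEP 3–4, §4; Dupuis–Chitov,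
Phys. Rev. B 54 (1996) 3040 (thermal factor of the ZS graph).
-/

noncomputable section

namespace Summit.HubbardSuperconductivity.HubbardSuperconductivity.Theorems.KLRegimeSplit

set_option linter.dupNamespace false -- summit = problem name (single-conjunct summit), D-0017

open Real Finset MeasureTheory Complex Literature.MathematicalPhysics.QuantumLattice
open Summit.HubbardSuperconductivity.HubbardSuperconductivity.Theorems

/-! ## §1 The singularity-free radial integrand `Ψ_G(k₀,e) = G(k₀²+e²)·(ik₀+e)²` -/

/-- `‖ik₀ + e‖² = k₀² + e²` for real `k₀, e`. -/
theorem klzd_norm_sq_lin (k₀ e : ℝ) : ‖(I * k₀ + e : ℂ)‖ ^ 2 = k₀ ^ 2 + e ^ 2 := by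
  rw [Complex.sq_norm, Complex.normSq_apply]
  simp; ring

/-- `‖ik₀ + e‖ = √(k₀² + e²)`. -/
theorem klzd_norm_lin (k₀ e : ℝ) : ‖(I * k₀ + e : ℂ)‖ = Real.sqrt (k₀ ^ 2 + e ^ 2) := by
  rw [← klzd_norm_sq_lin, Real.sqrt_sq (norm_nonneg _)]

/-- `‖(ik₀ + e)²‖ = k₀² + e²`. -/
theorem klzd_norm_lin_sq (k₀ e : ℝ) : ‖((I * k₀ + e : ℂ)) ^ 2‖ = k₀ ^ 2 + e ^ 2 := by
  rw [norm_pow, klzd_norm_sq_lin]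

/-- **The two forms of the zero-sound integrand agree**: `G(s)·(ik₀+e)² = (G(s)·s²)·((−ik₀+e)²)⁻¹`, `s = k₀² + e²` (also at `s = 0`, where
both sides vanish by `0⁻¹ = 0`). -/
theorem klzd_integrand_eq (G : ℝ → ℂ) (k₀ e : ℝ) :
    G (k₀ ^ 2 + e ^ 2) * (I * k₀ + e) ^ 2 =
      (G (k₀ ^ 2 + e ^ 2) * ((k₀ ^ 2 + e ^ 2 : ℝ) : ℂ) ^ 2) * ((-I * k₀ + e) ^ 2)⁻¹ := by
  by_cases hz : (-I * k₀ + e : ℂ) = 0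
  · -- then `k₀ = e = 0`
    have hre := congrArg Complex.re hz
    have him := congrArg Complex.im hz
    simp at hre him
    subst hre; subst him
    simp
  · have hprod : (I * k₀ + e : ℂ) * (-I * k₀ + e) = ((k₀ ^ 2 + e ^ 2 : ℝ) : ℂ) := by
      push_cast; ring_nf; rw [Complex.I_sq]; ring
    rw [eq_mul_inv_iff_mul_eq₀ (pow_ne_zero 2 hz), ← hprod]
    ring

/-- **The continuum zero-sound bubble vanishes in the `Ψ_G` form**: `∫∫ G(k₀²+e²)(ik₀+e)² dk₀ de = 0` (from p1's
`klzs_integral_radial_mul_inv_pow_eq_zero` with `F(s) = G(s)s²`). -/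
theorem klzd_integral_plane_eq_zero (G : ℝ → ℂ) :
    ∫ p : ℝ × ℝ, G (p.1 ^ 2 + p.2 ^ 2) * (I * p.1 + p.2) ^ 2 = 0 := by
  have h := klzs_integral_radial_mul_inv_pow_eq_zero (fun s : ℝ => G s * ((s : ℝ) : ℂ) ^ 2) (n := 2) two_ne_zero
  rw [← h]
  refine integral_congr_ae (Filter.Eventually.of_forall fun p => ?_)
  exact klzd_integrand_eq G p.1 p.2

section Weight

variable {G : ℝ → ℂ} {L r : ℝ}

/-- The weight is bounded by `L·r²` on `s ≥ 0` (Lipschitz and vanishing at `r²`). -/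
theorem klzd_norm_G_le (hlip : ∀ s s', ‖G s - G s'‖ ≤ L * |s - s'|) (hsupp : ∀ s, r ^ 2 ≤ s → G s = 0) {s : ℝ} (hs : 0 ≤ s) :
    ‖G s‖ ≤ L * r ^ 2 := by
  rcases le_or_gt (r ^ 2) s with h | h
  · rw [hsupp s h, norm_zero]
    have hL : 0 ≤ L := by
      have := hlip 0 1; have h0 : (0:ℝ) ≤ ‖G 0 - G 1‖ := norm_nonneg _; norm_num at this; linarith
    positivity
  · have := hlip s (r ^ 2)
    rw [hsupp (r ^ 2) le_rfl, sub_zero] at this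
    refine this.trans (mul_le_mul_of_nonneg_left ?_ ?_)
    · rw [abs_of_nonpos (by linarith)]; linarith
    · have := hlip 0 1; have h0 : (0:ℝ) ≤ ‖G 0 - G 1‖ := norm_nonneg _; norm_num at this; linarith

/-- Off the disc the integrand vanishes: `G(k₀²+e²)(ik₀+e)² = 0` when `r ≤ |k₀|` … -/
theorem klzd_integrand_zero_of_le_abs_fst (hsupp : ∀ s, r ^ 2 ≤ s → G s = 0) {k₀ : ℝ} (hk : r ≤ |k₀|) (hr : 0 ≤ r) (e : ℝ) :
    G (k₀ ^ 2 + e ^ 2) * (I * k₀ + e) ^ 2 = 0 := by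
  have : r ^ 2 ≤ k₀ ^ 2 + e ^ 2 := by nlinarith [sq_abs k₀, sq_nonneg e, abs_nonneg k₀]
  rw [hsupp _ this, zero_mul]

/-- … or when `r ≤ |e|`. -/
theorem klzd_integrand_zero_of_le_abs_snd (hsupp : ∀ s, r ^ 2 ≤ s → G s = 0) (k₀ : ℝ) {e : ℝ} (he : r ≤ |e|) (hr : 0 ≤ r) :
    G (k₀ ^ 2 + e ^ 2) * (I * k₀ + e) ^ 2 = 0 := by
  have : r ^ 2 ≤ k₀ ^ 2 + e ^ 2 := by nlinarith [sq_abs e, sq_nonneg k₀, abs_nonneg e]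
  rw [hsupp _ this, zero_mul]

/-- Auxiliary (the mixed case of the Lipschitz estimate): if `k₀² + e² < r² ≤ k₀'² + e²` then
`‖G(k₀²+e²)(ik₀+e)²‖ ≤ 3Lr³·|k₀ − k₀'|`. -/
theorem klzd_lipschitz_aux (hlip : ∀ s s', ‖G s - G s'‖ ≤ L * |s - s'|) (hsupp : ∀ s, r ^ 2 ≤ s → G s = 0) (hr : 0 < r)
    {k₀ k₀' e : ℝ} (hs : k₀ ^ 2 + e ^ 2 < r ^ 2) (hs' : r ^ 2 ≤ k₀' ^ 2 + e ^ 2) :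
    ‖G (k₀ ^ 2 + e ^ 2) * (I * k₀ + e) ^ 2‖ ≤ 3 * L * r ^ 3 * |k₀ - k₀'| := by
  have hL : 0 ≤ L := by
    have := hlip 0 1; have h0 : (0:ℝ) ≤ ‖G 0 - G 1‖ := norm_nonneg _; norm_num at this; linarith
  have hk : |k₀| < r := by nlinarith [sq_abs k₀, sq_nonneg e, abs_nonneg k₀]
  have hklt : |k₀| < |k₀'| := by nlinarith [sq_abs k₀, sq_abs k₀', abs_nonneg k₀, abs_nonneg k₀']
  rw [norm_mul, klzd_norm_lin_sq]
  -- `‖G s‖ ≤ L (s' − s)` (G vanishes at s') and `‖G s‖ ≤ L r²`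
  have hG1 : ‖G (k₀ ^ 2 + e ^ 2)‖ ≤ L * (k₀' ^ 2 - k₀ ^ 2) := by
    have := hlip (k₀ ^ 2 + e ^ 2) (k₀' ^ 2 + e ^ 2)
    rw [hsupp _ hs', sub_zero] at this
    refine this.trans (le_of_eq ?_)
    rw [abs_of_nonpos (by linarith)]; ring
  have hG2 : ‖G (k₀ ^ 2 + e ^ 2)‖ ≤ L * r ^ 2 := klzd_norm_G_le hlip hsupp (by positivity)
  have hs0 : 0 ≤ k₀ ^ 2 + e ^ 2 := by positivity
  rcases le_or_gt (|k₀'|) (2 * r) with hsmall | hbig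
  · -- `|k₀ + k₀'| ≤ 3r`
    have h1 : k₀' ^ 2 - k₀ ^ 2 ≤ 3 * r * |k₀ - k₀'| := by
      have : k₀' ^ 2 - k₀ ^ 2 = (k₀' + k₀) * (k₀' - k₀) := by ring
      rw [this]
      calc (k₀' + k₀) * (k₀' - k₀) ≤ |(k₀' + k₀) * (k₀' - k₀)| := le_abs_self _
        _ = |k₀' + k₀| * |k₀ - k₀'| := by rw [abs_mul, abs_sub_comm]
        _ ≤ 3 * r * |k₀ - k₀'| := by
            refine mul_le_mul_of_nonneg_right ?_ (abs_nonneg _)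
            exact (abs_add_le _ _).trans (by linarith [hk.le])
    calc ‖G (k₀ ^ 2 + e ^ 2)‖ * (k₀ ^ 2 + e ^ 2) ≤ L * (k₀' ^ 2 - k₀ ^ 2) * r ^ 2 :=
          mul_le_mul hG1 hs.le hs0 (by nlinarith)
      _ ≤ L * (3 * r * |k₀ - k₀'|) * r ^ 2 := by gcongr
      _ = 3 * L * r ^ 3 * |k₀ - k₀'| := by ring
  · -- `|k₀ − k₀'| ≥ r`
    have h1 : r ≤ |k₀ - k₀'| := by
      have := abs_sub_abs_le_abs_sub k₀' k₀
      rw [abs_sub_comm] at this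
      linarith [hk.le]
    calc ‖G (k₀ ^ 2 + e ^ 2)‖ * (k₀ ^ 2 + e ^ 2) ≤ L * r ^ 2 * r ^ 2 := mul_le_mul hG2 hs.le hs0 (by positivity)
      _ = L * r ^ 3 * r := by ring
      _ ≤ L * r ^ 3 * |k₀ - k₀'| := by gcongr
      _ ≤ 3 * L * r ^ 3 * |k₀ - k₀'| := by
          have : 0 ≤ L * r ^ 3 * |k₀ - k₀'| := by positivity
          linarith

/-- **`Ψ_G(·, e)` is `4Lr³`-Lipschitz in the frequency**, uniformly in `e`. -/
theorem klzd_lipschitz_fst (hlip : ∀ s s', ‖G s - G s'‖ ≤ L * |s - s'|) (hsupp : ∀ s, r ^ 2 ≤ s → G s = 0) (hr : 0 < r)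
    (e k₀ k₀' : ℝ) :
    ‖G (k₀ ^ 2 + e ^ 2) * (I * k₀ + e) ^ 2 - G (k₀' ^ 2 + e ^ 2) * (I * k₀' + e) ^ 2‖ ≤ 4 * L * r ^ 3 * |k₀ - k₀'| := by
  have hL : 0 ≤ L := by
    have := hlip 0 1; have h0 : (0:ℝ) ≤ ‖G 0 - G 1‖ := norm_nonneg _; norm_num at this; linarith
  have h0 : 0 ≤ 4 * L * r ^ 3 * |k₀ - k₀'| := by positivity
  by_cases hs : k₀ ^ 2 + e ^ 2 < r ^ 2 <;> by_cases hs' : k₀' ^ 2 + e ^ 2 < r ^ 2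
  · -- both inside the disc: `|k₀|, |k₀'|, |e| < r`
    have hk : |k₀| < r := by nlinarith [sq_abs k₀, sq_nonneg e, abs_nonneg k₀]
    have hk' : |k₀'| < r := by nlinarith [sq_abs k₀', sq_nonneg e, abs_nonneg k₀']
    set z : ℂ := I * k₀ + e with hz
    set z' : ℂ := I * k₀' + e with hz'
    have hzn : ‖z‖ < r := by
      rw [hz, klzd_norm_lin]; exact (Real.sqrt_lt' hr).mpr (by nlinarith)
    have hzn' : ‖z'‖ < r := by
      rw [hz', klzd_norm_lin]; exact (Real.sqrt_lt' hr).mpr (by nlinarith)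
    have hdiff : z - z' = I * ((k₀ - k₀' : ℝ) : ℂ) := by rw [hz, hz']; push_cast; ring
    have hndiff : ‖z - z'‖ = |k₀ - k₀'| := by
      rw [hdiff, norm_mul, Complex.norm_I, one_mul, Complex.norm_real, Real.norm_eq_abs]
    -- split: (G s − G s') z² + G s' (z² − z'²)
    have hsplit : G (k₀ ^ 2 + e ^ 2) * z ^ 2 - G (k₀' ^ 2 + e ^ 2) * z' ^ 2 =
        (G (k₀ ^ 2 + e ^ 2) - G (k₀' ^ 2 + e ^ 2)) * z ^ 2 + G (k₀' ^ 2 + e ^ 2) * ((z - z') * (z + z')) := by ring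
    rw [hsplit]
    have hA : ‖(G (k₀ ^ 2 + e ^ 2) - G (k₀' ^ 2 + e ^ 2)) * z ^ 2‖ ≤ 2 * L * r ^ 3 * |k₀ - k₀'| := by
      rw [norm_mul, hz, klzd_norm_lin_sq]
      have h1 : ‖G (k₀ ^ 2 + e ^ 2) - G (k₀' ^ 2 + e ^ 2)‖ ≤ L * (2 * r * |k₀ - k₀'|) := by
        refine (hlip _ _).trans (mul_le_mul_of_nonneg_left ?_ hL)
        have : k₀ ^ 2 + e ^ 2 - (k₀' ^ 2 + e ^ 2) = (k₀ + k₀') * (k₀ - k₀') := by ring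
        rw [this, abs_mul]
        refine mul_le_mul_of_nonneg_right ((abs_add_le _ _).trans (by linarith)) (abs_nonneg _)
      calc ‖G (k₀ ^ 2 + e ^ 2) - G (k₀' ^ 2 + e ^ 2)‖ * (k₀ ^ 2 + e ^ 2) ≤ L * (2 * r * |k₀ - k₀'|) * r ^ 2 :=
            mul_le_mul h1 hs.le (by positivity) (by positivity)
        _ = 2 * L * r ^ 3 * |k₀ - k₀'| := by ring
    have hB : ‖G (k₀' ^ 2 + e ^ 2) * ((z - z') * (z + z'))‖ ≤ 2 * L * r ^ 3 * |k₀ - k₀'| := by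
      rw [norm_mul, norm_mul, hndiff]
      have h1 : ‖G (k₀' ^ 2 + e ^ 2)‖ ≤ L * r ^ 2 := klzd_norm_G_le hlip hsupp (by positivity)
      have h2 : ‖z + z'‖ ≤ 2 * r := (norm_add_le _ _).trans (by linarith)
      calc ‖G (k₀' ^ 2 + e ^ 2)‖ * (|k₀ - k₀'| * ‖z + z'‖) ≤ L * r ^ 2 * (|k₀ - k₀'| * (2 * r)) := by
            gcongr
        _ = 2 * L * r ^ 3 * |k₀ - k₀'| := by ring
    calc _ ≤ ‖(G (k₀ ^ 2 + e ^ 2) - G (k₀' ^ 2 + e ^ 2)) * z ^ 2‖ + ‖G (k₀' ^ 2 + e ^ 2) * ((z - z') * (z + z'))‖ :=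
          norm_add_le _ _
      _ ≤ 2 * L * r ^ 3 * |k₀ - k₀'| + 2 * L * r ^ 3 * |k₀ - k₀'| := add_le_add hA hB
      _ = 4 * L * r ^ 3 * |k₀ - k₀'| := by ring
  · -- `k₀` inside, `k₀'` outside
    rw [hsupp _ (not_lt.mp hs'), zero_mul, sub_zero]
    refine (klzd_lipschitz_aux hlip hsupp hr hs (not_lt.mp hs')).trans ?_
    have : 0 ≤ L * r ^ 3 * |k₀ - k₀'| := by positivity
    linarith
  · -- `k₀` outside, `k₀'` inside
    rw [hsupp _ (not_lt.mp hs), zero_mul, zero_sub, norm_neg]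
    have h1 := klzd_lipschitz_aux hlip hsupp hr hs' (not_lt.mp hs)
    rw [abs_sub_comm] at h1
    refine h1.trans ?_
    have : 0 ≤ L * r ^ 3 * |k₀ - k₀'| := by positivity
    linarith
  · -- both outside
    rw [hsupp _ (not_lt.mp hs), hsupp _ (not_lt.mp hs'), zero_mul, zero_mul, sub_zero, norm_zero]
    exact h0

/-- `Ψ_G` is continuous on the plane (`G` Lipschitz). -/
theorem klzd_continuous (hlip : ∀ s s', ‖G s - G s'‖ ≤ L * |s - s'|) :
    Continuous fun p : ℝ × ℝ => G (p.1 ^ 2 + p.2 ^ 2) * (I * p.1 + p.2) ^ 2 := by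
  have hL : 0 ≤ L := by
    have := hlip 0 1; have h0 : (0:ℝ) ≤ ‖G 0 - G 1‖ := norm_nonneg _; norm_num at this; linarith
  have hG : Continuous G := by
    have hl : LipschitzWith (Real.toNNReal L) G := LipschitzWith.of_dist_le_mul fun t t' => by
      rw [dist_eq_norm, Real.dist_eq, Real.coe_toNNReal L hL]
      exact hlip t t'
    exact hl.continuous
  refine Continuous.mul (hG.comp (by continuity)) ?_
  continuity

/-- `Ψ_G` is integrable on the plane (continuous, supported in the closed ball of radius `r` for the sup norm). -/
theorem klzd_integrable (hlip : ∀ s s', ‖G s - G s'‖ ≤ L * |s - s'|) (hsupp : ∀ s, r ^ 2 ≤ s → G s = 0) (hr : 0 ≤ r) :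
    Integrable fun p : ℝ × ℝ => G (p.1 ^ 2 + p.2 ^ 2) * (I * p.1 + p.2) ^ 2 := by
  refine (klzd_continuous hlip).integrable_of_hasCompactSupport ?_
  refine HasCompactSupport.intro (isCompact_closedBall (0 : ℝ × ℝ) r) fun p hp => ?_
  rw [Metric.mem_closedBall, dist_zero_right, Prod.norm_def, not_le] at hp
  simp only [Real.norm_eq_abs] at hp
  rcases lt_max_iff.mp hp with h1 | h1
  · exact klzd_integrand_zero_of_le_abs_fst hsupp h1.le hr _
  · exact klzd_integrand_zero_of_le_abs_snd hsupp _ h1.le hr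

/-! ## §2 The frequency function `g(k₀) = ∫ Ψ_G(k₀, e) de` -/

/-- `g(k₀) = 0` for `|k₀| ≥ r`. -/
theorem klzd_freqFn_zero (hsupp : ∀ s, r ^ 2 ≤ s → G s = 0) (hr : 0 ≤ r) {k₀ : ℝ} (hk : r ≤ |k₀|) :
    ∫ e : ℝ, G (k₀ ^ 2 + e ^ 2) * (I * k₀ + e) ^ 2 = 0 := by
  simp_rw [klzd_integrand_zero_of_le_abs_fst hsupp hk hr]
  exact integral_zero _ _

/-- **`g` is `8Lr⁴`-Lipschitz**: the `e`-integrand difference is `≤ 4Lr³|k₀−k₀'|` and lives on `|e| ≤ r`. -/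
theorem klzd_freqFn_lipschitz (hlip : ∀ s s', ‖G s - G s'‖ ≤ L * |s - s'|) (hsupp : ∀ s, r ^ 2 ≤ s → G s = 0) (hr : 0 < r)
    (k₀ k₀' : ℝ) :
    ‖(∫ e : ℝ, G (k₀ ^ 2 + e ^ 2) * (I * k₀ + e) ^ 2) - ∫ e : ℝ, G (k₀' ^ 2 + e ^ 2) * (I * k₀' + e) ^ 2‖ ≤
      8 * L * r ^ 4 * |k₀ - k₀'| := by
  have hL : 0 ≤ L := by
    have := hlip 0 1; have h0 : (0:ℝ) ≤ ‖G 0 - G 1‖ := norm_nonneg _; norm_num at this; linarith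
  -- integrability of each slice (continuous, compactly supported in `e`)
  have hint : ∀ k : ℝ, Integrable fun e : ℝ => G (k ^ 2 + e ^ 2) * (I * k + e) ^ 2 := by
    intro k
    have hc : Continuous fun e : ℝ => G (k ^ 2 + e ^ 2) * (I * k + e) ^ 2 :=
      (klzd_continuous hlip).comp (Continuous.prodMk continuous_const continuous_id)
    refine hc.integrable_of_hasCompactSupport ?_
    refine HasCompactSupport.intro (isCompact_Icc (a := -r) (b := r)) fun e he => ?_
    rw [Set.mem_Icc, not_and_or, not_le, not_le] at he
    have : r ≤ |e| := by
      rcases he with h | h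
      · exact le_trans (by linarith) (neg_le_abs e)
      · exact le_trans h.le (le_abs_self e)
    exact klzd_integrand_zero_of_le_abs_snd hsupp k this hr.le
  rw [← integral_sub (hint k₀) (hint k₀')]
  -- pointwise bound by the indicator of `[-r, r]` times the Lipschitz constant
  set c : ℝ := 4 * L * r ^ 3 * |k₀ - k₀'| with hc
  have hbound : ∀ e : ℝ, ‖G (k₀ ^ 2 + e ^ 2) * (I * k₀ + e) ^ 2 - G (k₀' ^ 2 + e ^ 2) * (I * k₀' + e) ^ 2‖ ≤
      Set.indicator (Set.Icc (-r) r) (fun _ => c) e := by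
    intro e
    by_cases he : e ∈ Set.Icc (-r) r
    · rw [Set.indicator_of_mem he]
      exact klzd_lipschitz_fst hlip hsupp hr e k₀ k₀'
    · rw [Set.indicator_of_notMem he]
      rw [Set.mem_Icc, not_and_or, not_le, not_le] at he
      have : r ≤ |e| := by
        rcases he with h | h
        · exact le_trans (by linarith) (neg_le_abs e)
        · exact le_trans h.le (le_abs_self e)
      rw [klzd_integrand_zero_of_le_abs_snd hsupp k₀ this hr.le, klzd_integrand_zero_of_le_abs_snd hsupp k₀' this hr.le,
        sub_zero, norm_zero]
  have hind : Integrable (Set.indicator (Set.Icc (-r) r) (fun _ : ℝ => c)) := by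
    refine IntegrableOn.integrable_indicator ?_ measurableSet_Icc
    exact integrableOn_const (by rw [Real.volume_Icc]; exact ENNReal.ofReal_ne_top)
  calc ‖∫ e : ℝ, (G (k₀ ^ 2 + e ^ 2) * (I * k₀ + e) ^ 2 - G (k₀' ^ 2 + e ^ 2) * (I * k₀' + e) ^ 2)‖
      ≤ ∫ e : ℝ, Set.indicator (Set.Icc (-r) r) (fun _ => c) e := norm_integral_le_of_norm_le hind (Filter.Eventually.of_forall hbound)
    _ = (volume (Set.Icc (-r) r)).toReal * c := by rw [integral_indicator_const _ measurableSet_Icc, smul_eq_mul, Measure.real]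
    _ = 2 * r * c := by rw [Real.volume_Icc, ENNReal.toReal_ofReal (by linarith)]; ring
    _ = 8 * L * r ^ 4 * |k₀ - k₀'| := by rw [hc]; ring

/-- **The continuum frequency integral of `g` vanishes**: `∫ dk₀ ∫ de Ψ_G = ∫∫ Ψ_G = 0` (Fubini + the angular cancellation). -/
theorem klzd_integral_freqFn_eq_zero (hlip : ∀ s s', ‖G s - G s'‖ ≤ L * |s - s'|) (hsupp : ∀ s, r ^ 2 ≤ s → G s = 0)
    (hr : 0 ≤ r) : ∫ k₀ : ℝ, ∫ e : ℝ, G (k₀ ^ 2 + e ^ 2) * (I * k₀ + e) ^ 2 = 0 := by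
  have hI := klzd_integrable hlip hsupp hr
  have h := integral_prod (μ := (volume : Measure ℝ)) (ν := (volume : Measure ℝ))
    (f := fun p : ℝ × ℝ => G (p.1 ^ 2 + p.2 ^ 2) * (I * p.1 + p.2) ^ 2) (by rwa [← Measure.volume_eq_prod])
  simp only at h
  rw [← h, ← Measure.volume_eq_prod]
  exact klzd_integral_plane_eq_zero G

/-! ## §3 The discrete bubble -/

/-- **The zero-sound bubble of a radial weight at finite temperature is bounded by the Riemann error alone.**  For `G : ℝ → ℂ`
`L`-Lipschitz with `G(s) = 0` for `s ≥ r²` (`r > 0`), `β > 0` and every Matsubara cutoff `M ≥ βr/(2π) + 1`: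
`‖β⁻¹ • Σ_{i : MatsubaraIdx M} ∫ G(ω_i² + e²)(iω_i + e)² de‖ ≤ 8·L·r⁴·(r + 2π/β)/β`. -/
theorem klzd_discrete_zeroSound_bubble_norm_le (hlip : ∀ s s', ‖G s - G s'‖ ≤ L * |s - s'|)
    (hsupp : ∀ s, r ^ 2 ≤ s → G s = 0) (hr : 0 < r) {β : ℝ} (hβ : 0 < β) {M : ℕ} (hM : β * r / (2 * Real.pi) + 1 ≤ M) :
    ‖β⁻¹ • ∑ i : MatsubaraIdx M,
        ∫ e : ℝ, G (matsubaraFreq β M i ^ 2 + e ^ 2) * (I * (matsubaraFreq β M i) + e) ^ 2‖ ≤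
      8 * L * r ^ 4 * (r + 2 * Real.pi / β) / β := by
  have hL : 0 ≤ L := by
    have := hlip 0 1; have h0 : (0:ℝ) ≤ ‖G 0 - G 1‖ := norm_nonneg _; norm_num at this; linarith
  set g : ℝ → ℂ := fun k₀ => ∫ e : ℝ, G (k₀ ^ 2 + e ^ 2) * (I * k₀ + e) ^ 2 with hg
  have hD : 0 ≤ 8 * L * r ^ 4 := by positivity
  have hglip : ∀ t t', ‖g t - g t'‖ ≤ 8 * L * r ^ 4 * |t - t'| := fun t t' => klzd_freqFn_lipschitz hlip hsupp hr t t'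
  have hgsupp : ∀ t, r ≤ |t| → g t = 0 := fun t ht => klzd_freqFn_zero hsupp hr.le ht
  have h := klmr_matsubara_sum_sub_integral_norm_le hD hglip hr.le hgsupp hβ hM
  rw [klzd_integral_freqFn_eq_zero hlip hsupp hr.le, smul_zero, sub_zero] at h
  exact h

end Weight

end Summit.HubbardSuperconductivity.HubbardSuperconductivity.Theorems.KLRegimeSplit

end
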